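import Literature.Probability.LatticeModels.DobrushinShlosmanWeightedKernel
import Summits.Ventures.YMGap.RobustBall.RobustStarDoorZdW
import HarnessLib

/-!
# Venture YMGap, track ROBUST-BALL — FINITE-VOLUME CLUSTERING WITH ANY BOUNDARY FIELD THROUGH THE WEIGHTED (arbitrary-range) `ℤ^d`
# STAR DOOR: the tier-2 diameter-weighted ball `MemBallZdW κ ε₀ ε₁` (interior form)

HONEST FRAMING. WHAT THIS IS: a venture file (cell `pub-ymgap`, track Y2 ROBUST-BALL, seat ds-3, theorems only), the weighted twin of
`StarKernelClusteringZd.lean` («C-KMIX-STAR», tier 2). ds-2's weighted star door `StarWindowBoundZdW γ t ρ reach r` (`StarDoorZdW.lean`; an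
array over ALL boundary links with GLOBAL window contraction and weighted received sum `Σ'_y K e^{t·reach} ≤ ρ`) gave uniqueness and clustering
of every GIBBS MEASURE (`abs_covariance_le_of_starWindowBoundZdW`). Here the Literature's kernel form of the weighted window comparison
(`DobrushinShlosman.abs_covariance_kernel_le_of_window_weighted_exp`: consistency instead of DLR) is fed with the same array and a kernel profile:
* `exists_starKernelProfileW` — for a finite link volume `Λ₀`, a `1`-Lipschitz depth function `φ` (`φ > 0 ⇒ ∈ Λ₀`) and supports `Δf, Δg`:
  `ρ x = min(dist(x, Δg) − 2, φ x − 1)` is `≤ 0` off `Λ₀` and on the links of `Λ₀` in no star `⊆ Λ₀` avoiding `Δg`, `1`-Lipschitz along the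
  reach, and `≥ min(dist(Δf, Δg) − 2, m − 1)` on `Δf` if `φ ≥ m` there (ds-2's `exists_starProfileW` with the box replaced by `φ`);
* ★★ `abs_covariance_kernel_le_of_starWindowBoundZdW` — DOOR LEVEL, any specification on the links of `ℤ^d` with `SU(N)` spins carrying the
  weighted star window bound (rate `t ≥ 0`, received sum `ρ < 1`, reach dominating the sup-distance from the star, Frobenius weight): for
  EVERY finite `Λ₀`, EVERY boundary field `η`, local Lipschitz `f` (`Δf ⊆ Λ₀`, `φ ≥ m` on `Δf`), `g`:
  `|cov_{γ_{Λ₀}(·|η)}(f, g)| ≤ 2(2√N)² e^{2t} e^{−t·min(dist(Δf,Δg), m + 1)} (Σ δf)(Σ δg)`;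
* ★★ `kernel_covariance_decay_of_robustStarW` — THE TIER-2 DIAMETER-WEIGHTED BALL: under the hypotheses of ds-2's
  `massGapOnBallZdW_of_robustStar` (near data of the tier-1 robust star door, weight `κ`, rate `0 < t ≤ κ`, closing inequality `≤ ρ' < 1`),
  for EVERY member `W ∈ MemBallZdW κ ε₀ ε₁`, every finite `Λ₀`, EVERY `η` and Lipschitz cylinders `F₁` (links `Λ₁ ⊆ Λ₀`, `φ ≥ m` on `Λ₁`), `F₂`:
  `|cov_{γ^{W,S}_{Λ₀}(·|η)}(F₁, F₂)| ≤ 2(2√N)² e^{2t} #Λ₁ #Λ₂ K₁ K₂ · e^{−t·min(dist(Λ₁,Λ₂), m + 1)}`.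
WHAT THIS IS NOT: interior form (the decay saturates at the depth of `F₁` inside `Λ₀`); no number (the `SU(2)` rows of the tier-2 star ball
are ds-2's `MassGapOnBallZdWRows`, to be joined when built); strong-coupling LATTICE statements; nothing continuum / Clay.

References: R. L. Dobrushin, S. B. Shlosman (1985) Thm. 1; H. Föllmer, LNM 1362 (1988) Ch. I (2.10), (2.13)–(2.14), (2.20); H.-O. Georgii
(2011) Remark 8.26; the Literature's `DobrushinShlosmanWeightedKernel.lean`; ds-2's `StarDoorZdW.lean` (profile device), `RobustStarDoorZdW.lean`.
-/

noncomputable section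

open MeasureTheory ProbabilityTheory Function Finset Real
open scoped NNReal
open Literature.Probability.LatticeModels
open Literature.Probability.LatticeModels.DobrushinMetric (IsLipBound)
open Literature.MathematicalPhysics.QuantumLattice hiding torusNorm
open Literature.MathematicalPhysics.QuantumFieldTheory (suFrobDist suFrobDist_nonneg suFrobDist_le
  suFrobDist_self suEntries dist_suEntries_le_suFrobDist IsLipschitzCylinder
  setDistEdges linkSetDist linkSetDist_nonneg linkSetDist_eq_zero_of_mem setDistEdges_le_linkSetDist
  setDistEdges_nonneg)
open Literature.MathematicalPhysics.QuantumFieldTheory.Balaban1983to89.StrongCouplingDobrushinWindow (OneLinkKRModulus)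
open Summit.Ventures.YMGap.DSWindowZd
open Summit.Ventures.YMGap.StarResolventDim (gaugeR doorPoly)

namespace Summit.Ventures.YMGap.RobustBall

variable {d N : ℕ}

/-! ### The kernel profile, real weighted form -/

/-- **THE KERNEL PROFILE FOR THE WEIGHTED STAR WINDOWS.** For a finite link volume `Λ₀`, a depth function `φ` (`φ x ≤ φ y + ‖x.1 − y.1‖_∞`,
`φ x > 0 ⇒ x ∈ Λ₀`), a reach dominating the sup-distance from the star, and supports `Δf, Δg`: the real profile
`ρ x = min(dist(x, Δg) − 2, φ x − 1)` satisfies `ρ ≤ 0` off `Λ₀`; `ρ ≤ 0` on the links of `Λ₀` lying in no star `⊆ Λ₀` (centred in `Λ₀`) that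
avoids `Δg`; `ρ x ≤ ρ y + reach(c.1, y)` along every star; and `ρ ≥ min(dist(Δf, Δg) − 2, m − 1)` on `Δf` whenever `φ ≥ m` there. [folklore] -/
theorem exists_starKernelProfileW (reach : Site d → ZdEdge d → ℝ)
    (hreach : ∀ (s : Site d), ∀ x ∈ vertexStarZd s, ∀ y : ZdEdge d, ‖x.1 - y.1‖ ≤ reach s y)
    (K : Site d → ZdEdge d → ZdEdge d → ℝ) (Λ₀ Δf Δg : Finset (ZdEdge d)) (φ : ZdEdge d → ℝ)
    (hφ : ∀ x y : ZdEdge d, φ x ≤ φ y + ‖x.1 - y.1‖) (hφΛ : ∀ x, 0 < φ x → x ∈ Λ₀) {m : ℝ} (hm : ∀ x ∈ Δf, m ≤ φ x) :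
    ∃ ρ : ZdEdge d → ℝ,
      (∀ y, y ∉ Λ₀ → ρ y ≤ 0) ∧
      (∀ x ∈ Λ₀, (∀ c ∈ Λ₀, starWinZd c ⊆ Λ₀ → (∀ z ∈ starWinZd c, z ∉ Δg) → x ∉ starWinZd c) → ρ x ≤ 0) ∧
      (∀ c ∈ Λ₀, starWinZd c ⊆ Λ₀ → (∀ z ∈ starWinZd c, z ∉ Δg) → ∀ x ∈ starWinZd c, ∀ y,
        K c.1 y x ≠ 0 → ρ x ≤ ρ y + reach c.1 y) ∧
      (∀ x ∈ Δf, min (setDistEdges Δf Δg - 2) (m - 1) ≤ ρ x) := by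
  classical
  refine ⟨fun x => min (linkSetDist Δg x - 2) (φ x - 1), ?_, ?_, ?_, ?_⟩
  · intro y hy
    have h : φ y ≤ 0 := by
      by_contra h'
      exact hy (hφΛ y (not_le.mp h'))
    exact (min_le_right _ _).trans (by linarith)
  · intro x hx hunc
    by_cases hdeep : 1 < φ x
    · -- the own star of `x` lies inside `Λ₀` (depth), hence meets `Δg`: `dist(x, Δg) ≤ 2`
      have hsub : starWinZd x ⊆ Λ₀ := fun z hz => hφΛ z (by
        have h1 := hφ x z
        have h2 : ‖x.1 - z.1‖ ≤ 1 := by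
          rw [norm_sub_rev]; exact norm_sub_le_one_of_mem_vertexStarZd hz
        linarith)
      have hmeet : ∃ z ∈ starWinZd x, z ∈ Δg := by
        by_contra hcon
        exact hunc x hx hsub (fun z hz hzg => hcon ⟨z, hz, hzg⟩) (self_mem_starWinZd x)
      obtain ⟨z, hz, hzg⟩ := hmeet
      have h1 : linkSetDist Δg x ≤ linkSetDist Δg z + ‖x.1 - z.1‖ := linkSetDist_le_add_norm Δg x z
      rw [linkSetDist_eq_zero_of_mem hzg, zero_add] at h1
      have h2 := norm_sub_le_two_of_mem_vertexStarZd (self_mem_vertexStarZd x) hz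
      exact (min_le_left _ _).trans (by linarith)
    · exact (min_le_right _ _).trans (by linarith)
  · intro c _ _ _ x hx y _
    have h3 : linkSetDist Δg x ≤ linkSetDist Δg y + ‖x.1 - y.1‖ := linkSetDist_le_add_norm Δg x y
    have h4 : ‖x.1 - y.1‖ ≤ reach c.1 y := hreach c.1 x hx y
    have h5 := hφ x y
    calc min (linkSetDist Δg x - 2) (φ x - 1)
        ≤ min (linkSetDist Δg y - 2 + reach c.1 y) (φ y - 1 + reach c.1 y) := min_le_min (by linarith) (by linarith)
      _ = min (linkSetDist Δg y - 2) (φ y - 1) + reach c.1 y := min_add_add_right _ _ _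
  · intro x hx
    exact min_le_min (by linarith [setDistEdges_le_linkSetDist (Λ₂ := Δg) hx]) (by linarith [hm x hx])

/-! ### Door level: the weighted star window bound -/

/-- ★★ **FINITE-VOLUME CLUSTERING WITH ANY BOUNDARY FIELD THROUGH THE WEIGHTED STAR DOOR (arbitrary range), interior form.** Under the weighted
star window bound `StarWindowBoundZdW γ t ρ reach suFrobDist` (rate `t ≥ 0`, received sum `ρ < 1`, reach dominating the sup-distance from the
star) for a specification `γ` on the links of `ℤ^d` with `SU(N)` spins: for EVERY finite link volume `Λ₀`, EVERY boundary field `η`, every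
depth function `φ` of `Λ₀`, bounded measurable `f` (links `Δf ⊆ Λ₀`, `φ ≥ m` on `Δf`), `g` (links `Δg`) with Frobenius-Lipschitz vectors:
`|cov_{γ_{Λ₀}(·|η)}(f, g)| ≤ 2(2√N)² e^{2t} e^{−t·min(dist(Δf,Δg), m + 1)} (Σ δf)(Σ δg)` (Literature
`DobrushinShlosman.abs_covariance_kernel_le_of_window_weighted_exp` with the profile `exists_starKernelProfileW`). [folklore] -/
theorem abs_covariance_kernel_le_of_starWindowBoundZdW {γ : Specification (ZdEdge d) (SUN N)}
    (hγ : IsSpecification γ) {t ρ : ℝ} (ht : 0 ≤ t) (hρ0 : 0 ≤ ρ) (hρ1 : ρ < 1)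
    {reach : Site d → ZdEdge d → ℝ} (hreach0 : ∀ s y, 0 ≤ reach s y)
    (hreach : ∀ (s : Site d), ∀ x ∈ vertexStarZd s, ∀ y : ZdEdge d, ‖x.1 - y.1‖ ≤ reach s y)
    (h : StarWindowBoundZdW d N γ t ρ reach suFrobDist)
    (Λ₀ : Finset (ZdEdge d)) (η : LGConfig d (SUN N)) (φ : ZdEdge d → ℝ)
    (hφ : ∀ x y : ZdEdge d, φ x ≤ φ y + ‖x.1 - y.1‖) (hφΛ : ∀ x, 0 < φ x → x ∈ Λ₀)
    {f g : LGConfig d (SUN N) → ℝ} (hfm : Measurable f) (hgm : Measurable g) {Bf Bg : ℝ}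
    (hBf : ∀ σ, |f σ| ≤ Bf) (hBg : ∀ σ, |g σ| ≤ Bg) {Δf Δg : Finset (ZdEdge d)}
    (hfdep : DependsOn f (Δf : Set (ZdEdge d))) (hgdep : DependsOn g (Δg : Set (ZdEdge d)))
    {δf δg : ZdEdge d → ℝ} (hδf : IsLipBound suFrobDist f δf) (hδg : IsLipBound suFrobDist g δg)
    (hΔf : Δf ⊆ Λ₀) {m : ℝ} (hm : ∀ x ∈ Δf, m ≤ φ x) :
    |cov[f, g; γ Λ₀ η]| ≤ 2 * (2 * Real.sqrt N) ^ 2 * Real.exp (2 * t) *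
      Real.exp (-(t * min (setDistEdges Δf Δg) (m + 1))) * (∑ x ∈ Δf, δf x) * ∑ y ∈ Δg, δg y := by
  classical
  obtain ⟨K, hK0, hKs, hcontract, hsum⟩ := h
  have hR₀ : (0 : ℝ) ≤ 2 * Real.sqrt N := by positivity
  obtain ⟨ρf, hout, hunc, hlip, hmin⟩ := exists_starKernelProfileW reach hreach K Λ₀ Δf Δg φ hφ hφΛ hm
  have key := DobrushinShlosman.abs_covariance_kernel_le_of_window_weighted_exp hγ suFrobDist_nonneg suFrobDist_le
    hR₀ suFrobDist_self (win := starWinZd) (K := fun c => K c.1) (fun c y x => hK0 _ _ _) hcontract ht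
    (d := fun c y _ => reach c.1 y) (fun c y _ => hreach0 _ _) (fun c x => hKs c.1 x) hρ0 hρ1
    (fun c x hx => hsum c.1 x hx) Λ₀ η hfm hgm hBf hBg hfdep hgdep hδf hδg hΔf ρf hout hunc hlip hmin
  refine key.trans (le_of_eq ?_)
  have : Real.exp (-(t * (min (setDistEdges Δf Δg - 2) (m - 1)))) =
      Real.exp (2 * t) * Real.exp (-(t * min (setDistEdges Δf Δg) (m + 1))) := by
    rw [← Real.exp_add]; congr 1
    have hmin' : min (setDistEdges Δf Δg - 2) (m - 1) = min (setDistEdges Δf Δg) (m + 1) - 2 := by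
      rw [show m - 1 = (m + 1) - 2 by ring, min_sub_sub_right]
    rw [hmin']; ring
  rw [this]; ring

/-! ### The tier-2 diameter-weighted ball through ds-2's robust star door -/

/-- ★★ **C-KMIX-STAR ON THE TIER-2 DIAMETER-WEIGHTED `ℤ^d` BALL.** Under the hypotheses of ds-2's `massGapOnBallZdW_of_robustStar` (near data of the
tier-1 robust star door: one-link modulus `K` at radius `Rm ≥ 2(d−1)|β'|` for the tree coupling `N β'`, per-incidence coefficient `c`, cross row
`lam`, in-star row `θ < 1`, `doorPoly d c < 1`, near received sum `ρn`; weight `κ > 0`, rate `0 < t ≤ κ`, far bound `τb`, closing inequality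
`≤ ρ' < 1`): for EVERY member `W ∈ MemBallZdW κ ε₀ ε₁`, every finite link volume `Λ₀`, EVERY boundary field `η`, every depth function `φ` of `Λ₀` and
Lipschitz cylinders `F₁` (links `Λ₁ ⊆ Λ₀` with `φ ≥ m` on `Λ₁`), `F₂` (links `Λ₂`):
`|cov_{γ^{W,S}_{Λ₀}(·|η)}(F₁, F₂)| ≤ 2(2√N)² e^{2t} #Λ₁ #Λ₂ K₁ K₂ · e^{−t·min(dist(Λ₁,Λ₂), m + 1)}` — the DLR-state statement of the same door is
`massGapOnBallZdW_of_robustStar`. [folklore] -/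
theorem kernel_covariance_decay_of_robustStarW (hd : 2 ≤ d) (hN : 1 ≤ N)
    {β' κ ε₀ ε₁ Rm K c lam θ ρn t τb ρ' : ℝ} {D Kn : ℕ} (hD : 1 ≤ D)
    (hK : 0 ≤ K) (hRm : |(N : ℝ) * β'| / N * (2 * ((d : ℝ) - 1)) ≤ Rm) (hmod : OneLinkKRModulus N Rm K)
    (hε₁ : 0 ≤ ε₁)
    (hc : K * Real.exp ε₀ * (1 + 2 * Real.sqrt N * ε₁) * (|(N : ℝ) * β'| / N) ≤ c) (hlam : Real.sqrt N * ε₁ ≤ lam)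
    (hθ : θ = (2 * (d : ℝ) - 2) * c + lam) (hθ1 : θ < 1) (hcd : doorPoly d c < 1)
    (hρn : ρn = gaugeR d c + (lam + θ ^ Kn * (4 * d * lam)) / (1 - θ))
    (hκ : 0 < κ) (ht : 0 < t) (htκ : t ≤ κ)
    (hτb : (2 * Real.sqrt N) * (((d : ℝ) + 1) * Real.exp (-(κ * D)) * ε₁) ≤ τb)
    (hclose : Real.exp τb ^ 2 * Real.exp (t * ((max (2 * D) 1 + 2 : ℕ) + 1)) * ρn +
        (2 * Real.sqrt N) * (Real.exp τb ^ 2 + Real.exp τb ^ 4) * (((d : ℝ) + 1) * Real.exp (-(κ * D)) * ε₁) *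
          (Real.exp (t * ((max (2 * D) 1 + 2 : ℕ) + 1)) * ρn) +
        2 * (2 * Real.sqrt N) * (Real.exp τb ^ 2 + Real.exp τb ^ 4) *
          (((d : ℝ) + 1) * Real.exp (2 * t) * Real.exp (-((κ - t) * D)) * ε₁) ≤ ρ')
    (hρ'0 : 0 ≤ ρ') (hρ'1 : ρ' < 1)
    {W : Potential (ZdEdge d) (SUN N)} (hW : MemBallZdW κ ε₀ ε₁ W)
    (Λ₀ : Finset (ZdEdge d)) (η : LGConfig d (SUN N)) (φ : ZdEdge d → ℝ)
    (hφ : ∀ x y : ZdEdge d, φ x ≤ φ y + ‖x.1 - y.1‖) (hφΛ : ∀ x, 0 < φ x → x ∈ Λ₀)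
    {F₁ F₂ : LGConfig d (SUN N) → ℝ} {Λ₁ Λ₂ : Finset (ZdEdge d)} {K₁ K₂ : ℝ≥0}
    (hF₁ : IsLipschitzCylinder (fundamentalRep (Fin N)) F₁ Λ₁ K₁)
    (hF₂ : IsLipschitzCylinder (fundamentalRep (Fin N)) F₂ Λ₂ K₂) (hΛ₁ : Λ₁ ⊆ Λ₀) {m : ℝ} (hm : ∀ x ∈ Λ₁, m ≤ φ x) :
    |cov[F₁, F₂; perturbedYMS (d := d) (fundamentalRep (Fin N)) ((N : ℝ) * β') W Λ₀ η]| ≤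
      2 * (2 * Real.sqrt N) ^ 2 * Real.exp (2 * t) * Λ₁.card * Λ₂.card * ((K₁ : ℝ) * K₂) *
        Real.exp (-(t * min (setDistEdges Λ₁ Λ₂) (m + 1))) := by
  classical
  haveI : SecondCountableTopology (Matrix (Fin N) (Fin N) ℂ) :=
    inferInstanceAs (SecondCountableTopology (Fin N → Fin N → ℂ))
  haveI : SecondCountableTopology (SUN N) := Topology.IsEmbedding.subtypeVal.secondCountableTopology
  obtain ⟨Bm, hBm⟩ := hW.summable
  have hγ : IsSpecification (perturbedYMS (d := d) (fundamentalRep (Fin N)) ((N : ℝ) * β') W) :=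
    isSpecification_perturbedYMS _ (continuous_fundamentalRep (Fin N)) _ hBm hW.continuous hW.dependsOn
  have hD'eq : 2 * D + 2 ≤ max (2 * D) 1 + 2 := by omega
  have hnear : ∀ s : Site d, StarWindowBoundZdR d N
      (perturbedYM (d := d) (fundamentalRep (Fin N)) ((N : ℝ) * β') (truncZd D s W) (truncSuppZd D s))
      (max (2 * D) 1 + 2) ρn suFrobDist := fun s =>
    starWindowBoundZdR_of_memBallZdG hd hN hK hRm hmod hε₁ hc hlam hθ hθ1 hcd hρn (hW.truncZd_mem hκ.le D s)
  have h := starWindowBoundZdW_of_near (N := N) hD'eq hκ ht.le htκ hτb (by exact_mod_cast hclose) hW hnear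
  have hreach0 : ∀ (s : Site d) (y : ZdEdge d), 0 ≤ ‖y.1 - s‖ + 1 := fun s y => by positivity
  have hreach : ∀ (s : Site d), ∀ x ∈ vertexStarZd s, ∀ y : ZdEdge d, ‖x.1 - y.1‖ ≤ ‖y.1 - s‖ + 1 :=
    fun s x hx y => by
      calc ‖x.1 - y.1‖ = ‖(x.1 - s) - (y.1 - s)‖ := by congr 1; abel
        _ ≤ ‖x.1 - s‖ + ‖y.1 - s‖ := norm_sub_le _ _
        _ ≤ 1 + ‖y.1 - s‖ := by linarith [norm_sub_le_one_of_mem_vertexStarZd hx]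
        _ = ‖y.1 - s‖ + 1 := by ring
  have hA : ∀ a b : SUN N, dist (suEntries a) (suEntries b) ≤ 1 * suFrobDist a b := fun a b => by
    rw [one_mul]; exact dist_suEntries_le_suFrobDist a b
  have key := abs_covariance_kernel_le_of_starWindowBoundZdW hγ ht.le hρ'0 hρ'1 hreach0 hreach h Λ₀ η φ hφ hφΛ
    hF₁.measurable hF₂.measurable hF₁.abs_le hF₂.abs_le hF₁.dependsOn hF₂.dependsOn
    (hF₁.isLipBound zero_le_one hA) (hF₂.isLipBound zero_le_one hA) hΛ₁ hm
  have hsum₁ : ∑ y ∈ Λ₁, (if y ∈ Λ₁ then 1 * (K₁ : ℝ) else 0) = Λ₁.card * K₁ := by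
    rw [Finset.sum_ite_of_true (fun y hy => hy), Finset.sum_const, nsmul_eq_mul, one_mul]
  have hsum₂ : ∑ y ∈ Λ₂, (if y ∈ Λ₂ then 1 * (K₂ : ℝ) else 0) = Λ₂.card * K₂ := by
    rw [Finset.sum_ite_of_true (fun y hy => hy), Finset.sum_const, nsmul_eq_mul, one_mul]
  rw [hsum₁, hsum₂] at key
  calc |cov[F₁, F₂; perturbedYMS (d := d) (fundamentalRep (Fin N)) ((N : ℝ) * β') W Λ₀ η]|
      ≤ 2 * (2 * Real.sqrt N) ^ 2 * Real.exp (2 * t) * Real.exp (-(t * min (setDistEdges Λ₁ Λ₂) (m + 1))) *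
          (Λ₁.card * K₁) * (Λ₂.card * K₂) := key
    _ = 2 * (2 * Real.sqrt N) ^ 2 * Real.exp (2 * t) * Λ₁.card * Λ₂.card * ((K₁ : ℝ) * K₂) *
        Real.exp (-(t * min (setDistEdges Λ₁ Λ₂) (m + 1))) := by ring

end Summit.Ventures.YMGap.RobustBall

end
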